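import Literature.MathematicalPhysics.KineticTheory.RiemannLocalGibbsLimit
import Mathlib.Probability.Kernel.IonescuTulcea.Traj
import Mathlib.Probability.Kernel.WithDensity
import HarnessLib

/-!
# Existence of the local Gibbs state of the hard-sphere gas at small activity

Topic `Literature/MathematicalPhysics/KineticTheory`; PROOFS (no definitions, no named facts),
sixth file towards the discharge of
`Literature.MathematicalPhysics.KineticTheory.RiemannLocalGibbsExistsUnique`
(`RiemannLocalGibbsLaw.lean`).

* **Assembly of a consistent family of window laws** (`exists_measure_map_restrict_eq`): given
  probability measures `π_k` on configurations, consistent under restriction to the windows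
  `B(0,k) × ℝ³`, carried by configurations inside their window and dominated by a multiple of the
  reference Poisson law of the window, there is a probability measure `μ` on locally finite
  configurations of `ℝ³ × ℝ³` whose law in the window `B(0,k) × ℝ³` is `π_k` for every `k`.
  Construction: the densities `g_{k+1} = dπ_{k+1}/dP_{B(0,k+1)}` (Radon–Nikodym) and the
  superposition `P_{B(0,k+1)} = (P_{B(0,k)} ⊗ P_{shell k+1}) ∘ ∪⁻¹` give explicit Markov kernels
  "law of the configuration in the shell `k+1` given the configuration in `B(0,k)`"; the
  Ionescu-Tulcea theorem (Mathlib's `ProbabilityTheory.Kernel.trajMeasure`, valid on arbitrary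
  measurable spaces) produces the law of the whole sequence of shell configurations, and `μ` is its
  image under the superposition of all shells (a locally finite configuration: a compact set meets
  finitely many shells).
* **Existence** (`exists_isHsLocalGibbs_of_small_activity`; the hard-sphere, activity-function,
  marked case of the existence of infinite-volume Gibbs measures — e.g. Georgii 2011 §4.4, or the
  existence input of Michelen–Perkins 2021, Thm 3): at small activity (`2κ < 1`) the DLR equations
  `IsHsLocalGibbs σ ν` have a solution — the measure assembled from the local limits
  `exists_limit_marginals`: it is carried by hard-core configurations, and its DLR equation on a
  local event reduces, by locality of the specification, to the finite-window DLR identity of the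
  limit marginals; local events generate.

## References

* H.-O. Georgii, *Gibbs Measures and Phase Transitions* (2011), §4.4. [Georgii2011]
* C. Ionescu Tulcea (1949); Mathlib `ProbabilityTheory.Kernel.trajMeasure`.
* M. Michelen, W. Perkins, arXiv:2109.01094, Thm 3. [MichelenPerkins2021]
-/

noncomputable section

open MeasureTheory ProbabilityTheory Set Filter
open scoped ENNReal NNReal Topology

namespace Literature.MathematicalPhysics.KineticTheory

open Literature.Analysis.FunctionSpaces
open Literature.MathematicalPhysics.StatisticalMechanics
open Literature.MathematicalPhysics.StatisticalMechanics.HardSphere (Pos Phase window hardCoreSet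
  glue poissonLaw IsHardCore)

/-! ### The shells `B(0,n) ∖ B(0,n-1)` -/

section Shells

/-- The shells of index `≤ k` lie in the ball `B(0,k)`. [folklore] -/
theorem shell_subset_ball_of_le {n k : ℕ} (h : n ≤ k) :
    Metric.ball (0 : Pos) n \ Metric.ball 0 ((n - 1 : ℕ) : ℝ) ⊆ Metric.ball (0 : Pos) k :=
  sdiff_subset.trans (Metric.ball_subset_ball (Nat.cast_le.2 h))

/-- The shells of index `> k` do not meet the ball `B(0,k)`. [folklore] -/
theorem shell_disjoint_ball_of_lt {n k : ℕ} (h : k < n) :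
    Disjoint (Metric.ball (0 : Pos) n \ Metric.ball 0 ((n - 1 : ℕ) : ℝ)) (Metric.ball (0 : Pos) k) := by
  rw [Set.disjoint_left]
  rintro q ⟨-, hq⟩ hq'
  refine hq (Metric.ball_subset_ball ?_ hq')
  exact_mod_cast Nat.le_sub_one_of_lt h

/-- The shells are pairwise disjoint. [folklore] -/
theorem pairwise_disjoint_shell :
    Pairwise (Function.onFun Disjoint fun n : ℕ =>
      Metric.ball (0 : Pos) n \ Metric.ball 0 ((n - 1 : ℕ) : ℝ)) := by
  intro n n' hnn'
  rcases lt_or_gt_of_ne hnn' with h | h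
  · exact Disjoint.mono_left sdiff_subset (shell_disjoint_ball_of_lt h).symm
  · exact Disjoint.mono_right sdiff_subset (shell_disjoint_ball_of_lt h)

/-- A point of `B(0,k)` lies in some shell of index `≤ k`. [folklore] -/
theorem exists_mem_shell_of_mem_ball {k : ℕ} {q : Pos} (hq : q ∈ Metric.ball (0 : Pos) k) :
    ∃ n ≤ k, q ∈ Metric.ball (0 : Pos) n \ Metric.ball 0 ((n - 1 : ℕ) : ℝ) := by
  classical
  have hex : ∃ n : ℕ, q ∈ Metric.ball (0 : Pos) n := ⟨k, hq⟩
  refine ⟨Nat.find hex, (Nat.find_min' hex hq), Nat.find_spec hex, fun h => ?_⟩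
  have hpos : 0 < Nat.find hex := by
    by_contra h0
    rw [not_lt, Nat.le_zero] at h0
    have := Nat.find_spec hex
    rw [h0, Nat.cast_zero, Metric.mem_ball, dist_zero_right] at this
    exact absurd this (not_lt.2 (norm_nonneg _))
  exact Nat.find_min hex (Nat.sub_one_lt_of_lt hpos) h

/-- The shell `k+1` is `B(0,k+1) ∖ B(0,k)`. [folklore] -/
theorem shell_succ (k : ℕ) :
    Metric.ball (0 : Pos) ((k + 1 : ℕ) : ℝ) \ Metric.ball 0 (((k + 1 - 1 : ℕ)) : ℝ) =
      Metric.ball (0 : Pos) ((k + 1 : ℕ) : ℝ) \ Metric.ball 0 (k : ℝ) := by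
  rw [Nat.add_sub_cancel]

end Shells

/-! ### Assembly of a consistent family of window laws -/

section Assembly

variable (ν : Measure Phase) [IsLocallyFiniteMeasure ν]

/-- **Assembly of a consistent family of window laws into a law on locally finite
configurations** (the projective-limit step of the existence proof, done with the Ionescu-Tulcea
theorem on the sequence of shell configurations — no topology on the configuration space is
needed).  Let `π_k` be probability measures on configurations of `ℝ³ × ℝ³`, `π_k` carried by
configurations inside `B(0,k) × ℝ³`, consistent (`π_{k+1}(·|_{B(0,k)} ∈ A') = π_k(A')`) and
dominated by a multiple of the Poisson reference law of the window.  Then there is a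
probability measure `μ` on locally finite configurations with `μ ∘ (·|_{B(0,k)})⁻¹ = π_k` for all
`k`.  Construction: with `g_{k+1} = dπ_{k+1}/dP_{B(0,k+1)}` and the superposition
`P_{B(0,k+1)} = (P_{B(0,k)} ⊗ P_{shell}) ∘ ∪⁻¹`, consistency gives `π_k = ḡ_k P_{B(0,k)}` with
`ḡ_k(u) = ∫ g_{k+1}(u ∪ s) P_{shell}(ds)`, the kernel `K_k(u, ds) = ḡ_k(u)⁻¹ g_{k+1}(u ∪ s) P_{shell}(ds)`
is Markov and `∫ K_k(u, {s | u ∪ s ∈ B}) π_k(du) = π_{k+1}(B)`; Ionescu-Tulcea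
(`ProbabilityTheory.Kernel.trajMeasure`) gives the law of the sequence of shell configurations,
whose partial superpositions have laws `π_k` (induction), and `μ` is the law of the full
superposition. [cite: Georgii2011, §4.4] -/
theorem exists_measure_map_restrict_eq (h0 : ∀ x, ν {x} = 0)
    (π : ℕ → Measure (PointConfig Phase)) (hπ : ∀ k, IsProbabilityMeasure (π k))
    (hcons : ∀ (k : ℕ) (A' : Set (PointConfig Phase)), MeasurableSet A' →
      π (k + 1) (PointConfig.restrict (window (Metric.ball (0 : Pos) k)) ⁻¹' A') = π k A')
    {C : ℕ → ℝ≥0∞}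
    (hdom : ∀ (k : ℕ) (A' : Set (PointConfig Phase)), MeasurableSet A' →
      π k A' ≤ C k * poissonLaw (ν.restrict (window (Metric.ball (0 : Pos) k))) A')
    (hsupp : ∀ k : ℕ, ∀ᵐ ξ ∂π k, ξ.restrict (window (Metric.ball (0 : Pos) k)) = ξ) :
    ∃ μ : Measure (PointConfig Phase), IsProbabilityMeasure μ ∧
      ∀ k : ℕ, μ.map (PointConfig.restrict (window (Metric.ball (0 : Pos) k))) = π k := by
  classical
  -- shells and windows
  set T : ℕ → Set Pos := fun n => Metric.ball (0 : Pos) n \ Metric.ball 0 ((n - 1 : ℕ) : ℝ) with hT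
  set S : ℕ → Set Phase := fun n => window (T n) with hS
  set W : ℕ → Set Phase := fun k => window (Metric.ball (0 : Pos) k) with hW
  have hTm : ∀ n, MeasurableSet (T n) := fun n =>
    Metric.isOpen_ball.measurableSet.diff Metric.isOpen_ball.measurableSet
  have hSm : ∀ n, MeasurableSet (S n) := fun n => HardSphere.measurableSet_window (hTm n)
  have hWm : ∀ k, MeasurableSet (W k) := fun k =>
    HardSphere.measurableSet_window Metric.isOpen_ball.measurableSet
  have hrm : ∀ k, Measurable (PointConfig.restrict (W k) : PointConfig Phase → PointConfig Phase) :=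
    fun k => PointConfig.measurable_restrict (hWm k)
  have hSW : ∀ {n k : ℕ}, n ≤ k → S n ⊆ W k := fun h => window_mono (shell_subset_ball_of_le h)
  have hSWdisj : ∀ {n k : ℕ}, k < n → Disjoint (S n) (W k) := fun h =>
    disjoint_window (shell_disjoint_ball_of_lt h)
  have hu : Measurable fun p : PointConfig Phase × PointConfig Phase => p.1 ∪ p.2 :=
    PointConfig.measurable_union'
  -- compact sets meet finitely many shells
  have hbound : ∀ K : Set Phase, IsCompact K → ∃ N : ℕ, ∀ p ∈ K, ‖p.1‖ < N := fun K hK => by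
    obtain ⟨R, hR⟩ := isBounded_iff_forall_norm_le.1 hK.isBounded
    refine ⟨⌈R⌉₊ + 1, fun p hp => ?_⟩
    calc ‖p.1‖ ≤ ‖p‖ := norm_fst_le p
      _ ≤ R := hR p hp
      _ ≤ ⌈R⌉₊ := Nat.le_ceil R
      _ < (⌈R⌉₊ + 1 : ℕ) := by push_cast; linarith
  have hshellN : ∀ {N n : ℕ} {p : Phase}, p ∈ S n → ‖p.1‖ < N → n < N + 1 := by
    intro N n p hp hpN
    have hp' : p.1 ∈ T n := by rw [hS, HardSphere.mem_window] at hp; exact hp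
    have h2 : p.1 ∉ Metric.ball (0 : Pos) ((n - 1 : ℕ) : ℝ) := hp'.2
    rw [mem_ball_zero_iff, not_lt] at h2
    have h3 : ((n - 1 : ℕ) : ℝ) < N := lt_of_le_of_lt h2 hpN
    have h4 : n - 1 < N := by exact_mod_cast h3
    omega
  -- the partial superpositions `V k` and the full superposition `U`
  set V : (k : ℕ) → ((i : ↥(Finset.Iic k)) → PointConfig Phase) → PointConfig Phase := fun k y =>
    { carrier := ⋃ i : ↥(Finset.Iic k), ((y i).carrier ∩ S i.1)
      finite_inter_isCompact := fun K hK => by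
        rw [Set.iUnion_inter]
        exact Set.finite_iUnion fun i => ((y i).finite_inter_isCompact K hK).subset
          fun x hx => ⟨hx.1.1, hx.2⟩ } with hV
  set U : (ℕ → PointConfig Phase) → PointConfig Phase := fun x =>
    { carrier := ⋃ n, ((x n).carrier ∩ S n)
      finite_inter_isCompact := fun K hK => by
        obtain ⟨N, hN⟩ := hbound K hK
        have hsub : (⋃ n, ((x n).carrier ∩ S n)) ∩ K ⊆
            ⋃ n ∈ Finset.range (N + 1), ((x n).carrier ∩ K) := by
          rintro p ⟨hp, hpK⟩
          obtain ⟨n, hpn⟩ := mem_iUnion.1 hp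
          exact mem_iUnion₂.2 ⟨n, Finset.mem_range.2 (hshellN hpn.2 (hN p hpK)), hpn.1, hpK⟩
        exact ((Finset.range (N + 1)).finite_toSet.biUnion fun n _ =>
          (x n).finite_inter_isCompact K hK).subset hsub } with hU
  have hmemV : ∀ (k : ℕ) (y : (i : ↥(Finset.Iic k)) → PointConfig Phase) (p : Phase),
      p ∈ V k y ↔ ∃ i : ↥(Finset.Iic k), p ∈ y i ∧ p ∈ S i.1 := by
    intro k y p
    change p ∈ ⋃ i : ↥(Finset.Iic k), ((y i).carrier ∩ S i.1) ↔ _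
    simp only [mem_iUnion, mem_inter_iff, PointConfig.mem_carrier]
  have hmemU : ∀ (x : ℕ → PointConfig Phase) (p : Phase), p ∈ U x ↔ ∃ n, p ∈ x n ∧ p ∈ S n := by
    intro x p
    change p ∈ ⋃ n, ((x n).carrier ∩ S n) ↔ _
    simp only [mem_iUnion, mem_inter_iff, PointConfig.mem_carrier]
  -- (R1) restriction of the full superposition
  have hR1 : ∀ (k : ℕ) (x : ℕ → PointConfig Phase),
      (U x).restrict (W k) = V k (Preorder.frestrictLe k x) := by
    intro k x
    refine PointConfig.ext fun p => ?_
    rw [mem_restrict_iff, hmemU, hmemV]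
    constructor
    · rintro ⟨⟨n, hpn, hpS⟩, hpW⟩
      have hnk : n ≤ k := by
        by_contra h
        exact Set.disjoint_left.1 (hSWdisj (not_le.1 h)) hpS hpW
      exact ⟨⟨n, Finset.mem_Iic.2 hnk⟩, hpn, hpS⟩
    · rintro ⟨i, hpi, hpS⟩
      exact ⟨⟨i.1, hpi, hpS⟩, hSW (Finset.mem_Iic.1 i.2) hpS⟩
  -- (R0) and (R2): the recursion of the partial superpositions
  have hR0 : ∀ y : (i : ↥(Finset.Iic 0)) → PointConfig Phase,
      V 0 y = (y ⟨0, Finset.mem_Iic.2 le_rfl⟩).restrict (S 0) := by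
    intro y
    refine PointConfig.ext fun p => ?_
    rw [hmemV, mem_restrict_iff]
    constructor
    · rintro ⟨⟨i, hi⟩, hpi, hpS⟩
      have hi0 : i = 0 := Nat.le_zero.1 (Finset.mem_Iic.1 hi)
      subst hi0
      exact ⟨hpi, hpS⟩
    · rintro ⟨hp, hpS⟩
      exact ⟨⟨0, Finset.mem_Iic.2 le_rfl⟩, hp, hpS⟩
  have hR2 : ∀ (k : ℕ) (y : (i : ↥(Finset.Iic (k + 1))) → PointConfig Phase),
      V (k + 1) y = V k (Preorder.frestrictLe₂ (π := fun _ : ℕ => PointConfig Phase) (Nat.le_succ k) y) ∪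
        (y ⟨k + 1, Finset.mem_Iic.2 le_rfl⟩).restrict (S (k + 1)) := by
    intro k y
    refine PointConfig.ext fun p => ?_
    rw [hmemV, PointConfig.mem_union, hmemV, mem_restrict_iff]
    constructor
    · rintro ⟨⟨i, hi⟩, hpi, hpS⟩
      rcases Nat.le_succ_iff.1 (Finset.mem_Iic.1 hi) with hik | hik
      · exact Or.inl ⟨⟨i, Finset.mem_Iic.2 hik⟩, hpi, hpS⟩
      · subst hik
        exact Or.inr ⟨hpi, hpS⟩
    · rintro (⟨⟨i, hi⟩, hpi, hpS⟩ | ⟨hp, hpS⟩)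
      · exact ⟨⟨i, Finset.mem_Iic.2 ((Finset.mem_Iic.1 hi).trans (Nat.le_succ k))⟩, hpi, hpS⟩
      · exact ⟨⟨k + 1, Finset.mem_Iic.2 le_rfl⟩, hp, hpS⟩
  -- measurability
  have hVm : ∀ k, Measurable (V k) := by
    intro k
    induction k with
    | zero =>
      rw [show V 0 = fun y => (y ⟨0, Finset.mem_Iic.2 le_rfl⟩).restrict (S 0) from funext hR0]
      exact (PointConfig.measurable_restrict (hSm 0)).comp (measurable_pi_apply _)
    | succ k ih =>
      rw [show V (k + 1) = fun y => V k (Preorder.frestrictLe₂ (π := fun _ : ℕ => PointConfig Phase) (Nat.le_succ k) y) ∪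
        (y ⟨k + 1, Finset.mem_Iic.2 le_rfl⟩).restrict (S (k + 1)) from funext (hR2 k)]
      exact hu.comp ((ih.comp (Preorder.measurable_frestrictLe₂ (X := fun _ : ℕ => PointConfig Phase) _)).prodMk
        ((PointConfig.measurable_restrict (hSm _)).comp (measurable_pi_apply _)))
  have hUm : Measurable U := by
    have h := measurable_generateFrom (f := U)
      (s := {A : Set (PointConfig Phase) | ∃ (k : ℕ) (A' : Set (PointConfig Phase)),
        MeasurableSet A' ∧ A = PointConfig.restrict (window (Metric.ball (0 : Pos) k)) ⁻¹' A'}) ?_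
    · exact h.mono le_rfl (le_of_eq generateFrom_localEvents.symm)
    · rintro A ⟨k, A', hA', rfl⟩
      have : U ⁻¹' (PointConfig.restrict (window (Metric.ball (0 : Pos) k)) ⁻¹' A') =
          (fun x => V k (Preorder.frestrictLe k x)) ⁻¹' A' := by
        ext x
        simp only [mem_preimage]
        rw [← hR1 k x]
      rw [this]
      exact ((hVm k).comp (Preorder.measurable_frestrictLe k)) hA'
  -- the reference laws
  set P : ℕ → Measure (PointConfig Phase) := fun k => poissonLaw (ν.restrict (W k)) with hP
  set PS : ℕ → Measure (PointConfig Phase) := fun n => poissonLaw (ν.restrict (S n)) with hPS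
  haveI hPprob : ∀ k, IsProbabilityMeasure (P k) := fun k => isProbabilityMeasure_poissonLaw _
  haveI hPSprob : ∀ n, IsProbabilityMeasure (PS n) := fun n => isProbabilityMeasure_poissonLaw _
  have hPae : ∀ k, ∀ᵐ u ∂P k, u.restrict (W k) = u := fun k => ae_restrict_eq_self ν h0 (hWm k)
  have hPSae : ∀ n, ∀ᵐ s ∂PS n, s.restrict (S n) = s := fun n => ae_restrict_eq_self ν h0 (hSm n)
  have hsup : ∀ k : ℕ, P (k + 1) = ((P k).prod (PS (k + 1))).map
      (fun p : PointConfig Phase × PointConfig Phase => p.1 ∪ p.2) := by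
    intro k
    have h := poissonLaw_window_eq_map_prod ν h0 (Λ := Metric.ball (0 : Pos) ((k + 1 : ℕ) : ℝ))
      (Δ := Metric.ball (0 : Pos) k) Metric.isOpen_ball.measurableSet Metric.isOpen_ball.measurableSet
      (Metric.ball_subset_ball (by push_cast; linarith))
    simp only [hP, hPS, hS, hT, hW, shell_succ]
    exact h
  -- restriction of a shell configuration to the inner window is empty
  have hrestr_shell : ∀ {k : ℕ} {s : PointConfig Phase}, s.restrict (S (k + 1)) = s →
      s.restrict (W k) = ∅ := by
    intro k s hs
    refine PointConfig.ext fun p => ⟨fun hp => ?_, fun hp => absurd hp (notMem_empty' p)⟩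
    rw [← hs] at hp
    exact absurd hp.2 (Set.disjoint_left.1 (hSWdisj (Nat.lt_succ_self k)) hp.1.2)
  have hrestr_union : ∀ {k : ℕ} {u s : PointConfig Phase}, u.restrict (W k) = u →
      s.restrict (S (k + 1)) = s → (u ∪ s).restrict (W k) = u := by
    intro k u s hu' hs
    rw [restrict_union', hu', hrestr_shell hs, union_empty']
  -- densities
  have habs : ∀ k, π k ≪ P k := fun k =>
    Measure.absolutelyContinuous_of_le_smul (c := C k) (Measure.le_iff.2 fun s hs => by
      rw [Measure.smul_apply, smul_eq_mul]; exact hdom k s hs)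
  set g : ℕ → PointConfig Phase → ℝ≥0∞ := fun k => (π (k + 1)).rnDeriv (P (k + 1)) with hg
  have hgm : ∀ k, Measurable (g k) := fun k => Measure.measurable_rnDeriv _ _
  have hπg : ∀ k, (P (k + 1)).withDensity (g k) = π (k + 1) := fun k =>
    Measure.withDensity_rnDeriv_eq _ _ (habs (k + 1))
  set gbar : ℕ → PointConfig Phase → ℝ≥0∞ := fun k u => ∫⁻ s, g k (u ∪ s) ∂PS (k + 1) with hgbar
  have hgum : ∀ k, Measurable fun p : PointConfig Phase × PointConfig Phase => g k (p.1 ∪ p.2) :=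
    fun k => (hgm k).comp hu
  have hgbarm : ∀ k, Measurable (gbar k) := fun k => (hgum k).lintegral_prod_right'
  have hgsm : ∀ k (u : PointConfig Phase), Measurable fun s : PointConfig Phase => g k (u ∪ s) :=
    fun k u => (hgm k).comp (hu.comp (measurable_const.prodMk measurable_id))
  -- (I1) consistency in density form: `π k = ḡ_k · P k`
  have hI1 : ∀ (k : ℕ) (B : Set (PointConfig Phase)), MeasurableSet B →
      π k B = ∫⁻ u in B, gbar k u ∂P k := by
    intro k B hB
    have hBk : MeasurableSet (PointConfig.restrict (W k) ⁻¹' B) := hB.preimage (hrm k)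
    rw [← hcons k B hB, ← hπg k, withDensity_apply _ hBk, ← lintegral_indicator hBk, hsup k,
      lintegral_map ((hgm k).indicator hBk) hu,
      lintegral_prod (fun p : PointConfig Phase × PointConfig Phase =>
        (PointConfig.restrict (W k) ⁻¹' B).indicator (g k) (p.1 ∪ p.2))
        (((hgm k).indicator hBk).comp hu).aemeasurable,
      ← lintegral_indicator hB]
    refine lintegral_congr_ae ((hPae k).mono fun u hu' => ?_)
    have hinner : ∀ᵐ s ∂PS (k + 1), (PointConfig.restrict (W k) ⁻¹' B).indicator (g k) (u ∪ s) =
        B.indicator (fun _ => g k (u ∪ s)) u := by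
      filter_upwards [hPSae (k + 1)] with s hs
      simp only [indicator, mem_preimage, hrestr_union hu' hs]
    change ∫⁻ s, (PointConfig.restrict (W k) ⁻¹' B).indicator (g k) (u ∪ s) ∂PS (k + 1) =
      B.indicator (gbar k) u
    rw [lintegral_congr_ae hinner]
    by_cases hmem : u ∈ B
    · simp only [indicator_of_mem hmem, hgbar]
    · simp only [indicator_of_notMem hmem, lintegral_zero]
  have hπeq : ∀ k, π k = (P k).withDensity (gbar k) := fun k =>
    Measure.ext fun B hB => by rw [hI1 k B hB, withDensity_apply _ hB]
  have hgbar_lt : ∀ k, ∀ᵐ u ∂P k, gbar k u < ∞ := by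
    intro k
    haveI := hπ k
    refine ae_lt_top (hgbarm k) ?_
    rw [← setLIntegral_univ, ← hI1 k univ MeasurableSet.univ]
    exact measure_ne_top _ _
  -- the shell kernels
  set f : ℕ → PointConfig Phase → PointConfig Phase → ℝ≥0∞ := fun k u s =>
    if 0 < gbar k u ∧ gbar k u < ∞ then (gbar k u)⁻¹ * g k (u ∪ s) else 1 with hf
  have hfm : ∀ k, Measurable (Function.uncurry (f k)) := by
    intro k
    refine Measurable.ite ?_ (((hgbarm k).comp measurable_fst).inv.mul (hgum k)) measurable_const
    exact (measurableSet_lt measurable_const ((hgbarm k).comp measurable_fst)).inter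
      (measurableSet_lt ((hgbarm k).comp measurable_fst) measurable_const)
  set K : ℕ → Kernel (PointConfig Phase) (PointConfig Phase) := fun k =>
    Kernel.withDensity (Kernel.const (PointConfig Phase) (PS (k + 1))) (f k) with hK
  have hKapply : ∀ (k : ℕ) (u : PointConfig Phase) (E : Set (PointConfig Phase)),
      K k u E = ∫⁻ s in E, f k u s ∂PS (k + 1) := by
    intro k u E
    rw [hK, Kernel.withDensity_apply' _ (hfm k), Kernel.const_apply]
  have hKmarkov : ∀ k, IsMarkovKernel (K k) := by
    intro k
    refine ⟨fun u => ⟨?_⟩⟩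
    rw [hKapply, Measure.restrict_univ]
    by_cases hgu : 0 < gbar k u ∧ gbar k u < ∞
    · simp only [hf, if_pos hgu]
      rw [lintegral_const_mul _ (hgsm k u), ENNReal.inv_mul_cancel hgu.1.ne' hgu.2.ne]
    · simp only [hf, if_neg hgu, lintegral_const, measure_univ, mul_one]
  set κ : (n : ℕ) → Kernel ((i : ↥(Finset.Iic n)) → PointConfig Phase) (PointConfig Phase) :=
    fun n => (K n).comap (V n) (hVm n) with hκ
  haveI hκmarkov : ∀ n, IsMarkovKernel (κ n) := fun n => by
    haveI := hKmarkov n; rw [hκ]; infer_instance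
  -- (I3) the one-step identity `∫ K_k(u, {s | u ∪ s|_S ∈ B}) π_k(du) = π_{k+1}(B)`
  have hEm : ∀ (k : ℕ) {B : Set (PointConfig Phase)}, MeasurableSet B →
      MeasurableSet {p : PointConfig Phase × PointConfig Phase |
        p.1 ∪ p.2.restrict (S (k + 1)) ∈ B} := by
    intro k B hB
    exact hB.preimage (hu.comp (measurable_fst.prodMk
      ((PointConfig.measurable_restrict (hSm _)).comp measurable_snd)))
  have hstep : ∀ (k : ℕ) (B : Set (PointConfig Phase)), MeasurableSet B →
      ∫⁻ u, K k u {ξ | u ∪ ξ.restrict (S (k + 1)) ∈ B} ∂π k = π (k + 1) B := by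
    intro k B hB
    have hΦm : Measurable fun u => K k u {ξ | u ∪ ξ.restrict (S (k + 1)) ∈ B} :=
      Kernel.measurable_kernel_prodMk_left (hEm k hB)
    -- both sides equal the double integral `∫∫ 1_B(u ∪ s) g(u ∪ s) dP_S dP_k`
    have hR : π (k + 1) B = ∫⁻ u, ∫⁻ s, B.indicator (g k) (u ∪ s) ∂PS (k + 1) ∂P k := by
      rw [← hπg k, withDensity_apply _ hB, ← lintegral_indicator hB, hsup k,
        lintegral_map ((hgm k).indicator hB) hu,
        lintegral_prod (fun p : PointConfig Phase × PointConfig Phase => B.indicator (g k) (p.1 ∪ p.2))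
          (((hgm k).indicator hB).comp hu).aemeasurable]
    rw [hR, hπeq k, lintegral_withDensity_eq_lintegral_mul _ (hgbarm k) hΦm]
    refine lintegral_congr_ae ?_
    filter_upwards [hPae k, hgbar_lt k] with u hu' hgu_lt
    change gbar k u * K k u {ξ | u ∪ ξ.restrict (S (k + 1)) ∈ B} =
      ∫⁻ s, B.indicator (g k) (u ∪ s) ∂PS (k + 1)
    have hind : ∀ᵐ s ∂PS (k + 1), ({ξ : PointConfig Phase | u ∪ ξ.restrict (S (k + 1)) ∈ B}).indicator
        (fun s => g k (u ∪ s)) s = B.indicator (g k) (u ∪ s) := by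
      filter_upwards [hPSae (k + 1)] with s hs
      simp only [indicator, mem_setOf_eq, hs]
    rw [hKapply]
    by_cases hg0 : gbar k u = 0
    · rw [hg0, zero_mul]
      refine (le_antisymm ?_ bot_le).symm
      calc ∫⁻ s, B.indicator (g k) (u ∪ s) ∂PS (k + 1) ≤ ∫⁻ s, g k (u ∪ s) ∂PS (k + 1) :=
            lintegral_mono fun s => indicator_le_self _ _ _
        _ = 0 := hg0
    · have hgu : 0 < gbar k u ∧ gbar k u < ∞ := ⟨pos_iff_ne_zero.2 hg0, hgu_lt⟩
      simp only [hf, if_pos hgu]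
      have hEu : MeasurableSet {ξ : PointConfig Phase | u ∪ ξ.restrict (S (k + 1)) ∈ B} :=
        measurable_prodMk_left (hEm k hB)
      rw [lintegral_const_mul _ (hgsm k u), ← mul_assoc, ENNReal.mul_inv_cancel hg0 hgu_lt.ne,
        one_mul, ← lintegral_indicator hEu, lintegral_congr_ae hind]
  -- the law of the shell sequence
  haveI := hπ 0
  set M : Measure (ℕ → PointConfig Phase) :=
    Kernel.trajMeasure (X := fun _ : ℕ => PointConfig Phase) (π 0) κ with hM
  -- the laws of the partial superpositions
  have hmarg : ∀ k : ℕ, (M.map (Preorder.frestrictLe k)).map (V k) = π k := by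
    intro k
    induction k with
    | zero =>
      have hM0 : M.map (Preorder.frestrictLe 0) =
          (π 0).map (MeasurableEquiv.piUnique (fun _ : ↥(Finset.Iic 0) => PointConfig Phase)).symm := by
        rw [hM, Kernel.trajMeasure, Measure.map_comp _ _ (Preorder.measurable_frestrictLe 0),
          Kernel.traj_map_frestrictLe, Kernel.partialTraj_self, Measure.id_comp]
      rw [hM0, Measure.map_map (hVm 0) (MeasurableEquiv.measurable _)]
      have hae : (V 0 ∘ ⇑(MeasurableEquiv.piUnique
          (fun _ : ↥(Finset.Iic 0) => PointConfig Phase)).symm) =ᵐ[π 0] id := by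
        filter_upwards [hsupp 0] with a ha
        rw [Function.comp_apply, hR0, id]
        have hempty : ∀ p, p ∉ a := fun p hp => by
          rw [← ha] at hp
          have h2 : p ∈ W 0 := hp.2
          rw [hW, HardSphere.mem_window, Nat.cast_zero, Metric.ball_zero] at h2
          exact h2
        refine PointConfig.ext fun p => ⟨fun hp => ?_, fun hp => absurd hp (hempty p)⟩
        exact absurd hp.1 (by
          have : (MeasurableEquiv.piUnique (fun _ : ↥(Finset.Iic 0) => PointConfig Phase)).symm a
            ⟨0, Finset.mem_Iic.2 le_rfl⟩ = a := by
            rw [MeasurableEquiv.piUnique_symm_apply]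
            have hd : (⟨0, Finset.mem_Iic.2 le_rfl⟩ : ↥(Finset.Iic 0)) = default := Subsingleton.elim _ _
            rw [hd, uniqueElim_default]
          rw [this]; exact hempty p)
      rw [Measure.map_congr hae, Measure.map_id]
    | succ k ih =>
      set G : ((i : ↥(Finset.Iic k)) → PointConfig Phase) × PointConfig Phase → PointConfig Phase :=
        fun p => V k p.1 ∪ (p.2).restrict (S (k + 1)) with hG
      have hGm : Measurable G :=
        hu.comp (((hVm k).comp measurable_fst).prodMk
          ((PointConfig.measurable_restrict (hSm _)).comp measurable_snd))
      have hpairm : Measurable fun x : ℕ → PointConfig Phase => (Preorder.frestrictLe k x, x (k + 1)) :=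
        (Preorder.measurable_frestrictLe k).prodMk (measurable_pi_apply _)
      have hrec : V (k + 1) ∘ Preorder.frestrictLe (k + 1) =
          G ∘ fun x : ℕ → PointConfig Phase => (Preorder.frestrictLe k x, x (k + 1)) := by
        funext x
        simp only [Function.comp_apply, hG]
        rw [hR2 k]
        rfl
      calc (M.map (Preorder.frestrictLe (k + 1))).map (V (k + 1))
          = M.map (V (k + 1) ∘ Preorder.frestrictLe (k + 1)) :=
            Measure.map_map (hVm _) (Preorder.measurable_frestrictLe _)
        _ = (M.map fun x : ℕ → PointConfig Phase => (Preorder.frestrictLe k x, x (k + 1))).map G := by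
            rw [hrec, Measure.map_map hGm hpairm]
        _ = (M.map (Preorder.frestrictLe k) ⊗ₘ κ k).map G := by
            rw [hM, Kernel.map_frestrictLe_trajMeasure_compProd_eq_map_trajMeasure]
        _ = π (k + 1) := by
            ext B hB
            haveI : SFinite (M.map (Preorder.frestrictLe k)) := inferInstance
            rw [Measure.map_apply hGm hB, Measure.compProd_apply (hGm hB)]
            have hΦm : Measurable fun u => K k u {ξ | u ∪ ξ.restrict (S (k + 1)) ∈ B} :=
              Kernel.measurable_kernel_prodMk_left (hEm k hB)
            have : (fun z : (i : ↥(Finset.Iic k)) → PointConfig Phase =>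
                (κ k z) (Prod.mk z ⁻¹' (G ⁻¹' B))) =
                (fun u => K k u {ξ | u ∪ ξ.restrict (S (k + 1)) ∈ B}) ∘ V k := by
              funext z
              simp only [Function.comp_apply, hκ, Kernel.comap_apply]
              rfl
            rw [this]
            change ∫⁻ z, (fun u => K k u {ξ | u ∪ ξ.restrict (S (k + 1)) ∈ B}) (V k z)
              ∂(M.map (Preorder.frestrictLe k)) = _
            rw [← lintegral_map hΦm (hVm k), ih, hstep k B hB]
  -- the assembled measure
  refine ⟨M.map U, Measure.isProbabilityMeasure_map hUm.aemeasurable, fun k => ?_⟩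
  rw [Measure.map_map (hrm k) hUm, show PointConfig.restrict (W k) ∘ U =
    V k ∘ Preorder.frestrictLe k from funext fun x => hR1 k x,
    ← Measure.map_map (hVm k) (Preorder.measurable_frestrictLe k), hmarg k]

end Assembly

/-! ### Existence of the DLR state -/

section Existence

variable (ν : Measure Phase) [IsLocallyFiniteMeasure ν] {σ : ℝ}

omit [IsLocallyFiniteMeasure ν] in
/-- The specification, as a function of the boundary condition with values in measures, is
measurable. [cite: Georgii2011, Def. 1.23] -/
theorem measurable_hsLocalSpec (σ : ℝ) {Λ : Set Pos} (hΛ : MeasurableSet Λ) :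
    Measurable fun η : PointConfig Phase => hsLocalSpec σ ν Λ η :=
  Measure.measurable_of_measurable_coe _ fun _ hs => measurable_hsLocalSpec_apply ν σ hΛ hs

/-- **Existence of the local Gibbs state of the hard-sphere gas at small activity** (the
hard-sphere, activity-function, velocity-marked case of the existence of infinite-volume Gibbs
measures, Georgii 2011 §4.4; the existence input of Michelen–Perkins 2021, Thm 3).  If the
one-particle intensity `ν` is locally finite, atomless, charges no hyperplane `{y₁ = t}`, gives
finite mass to the windows of balls and mass `≤ κ` with `2κ < 1` to every ball window `B°_σ(·)`,
then the DLR equations `IsHsLocalGibbs σ ν` have a solution: the law `μ` assembled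
(`exists_measure_map_restrict_eq`) from the local limits `π_k` of the free finite-volume
distributions (`exists_limit_marginals`).  It is carried by hard-core configurations (each `π_k`
is), and for a bounded region `Λ` and a local event `A` over `B(0,j)`, choosing `J ≥ j` with the
`σ`-neighbourhood of `Λ` inside `B(0,J)`, the DLR integral `∫ γ_Λ(A | η) dμ` only involves
`η|_{B(0,J)}` (locality), hence equals `∫ γ_Λ(A | ω) π_J(dω) = π_J = μ` on `A` by the
finite-window DLR identity of `π_J`; local events and the total mass determine the measure
`A ↦ ∫ γ_Λ(A | η) dμ`. [cite: MichelenPerkins2021, Thm 3] -/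
theorem exists_isHsLocalGibbs_of_small_activity (hσ : 0 < σ) (h0 : ∀ x, ν {x} = 0)
    (hm : ∀ t : ℝ, ν {y : Phase | y.1 0 = t} = 0) {κ : ℝ} (hκ0 : 0 ≤ κ)
    (hκ : ∀ a : Pos, ν (window (Metric.ball a σ)) ≤ ENNReal.ofReal κ) (hκ1 : 2 * κ < 1)
    (hfin : ∀ R : ℝ, ν (window (Metric.ball (0 : Pos) R)) ≠ ∞) :
    ∃ μ : Measure (PointConfig Phase), IsHsLocalGibbs σ ν μ := by
  classical
  obtain ⟨π, hπprob, hcons, hdom, hHC, hsupp, hDLR⟩ :=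
    exists_limit_marginals ν hσ h0 hm hκ0 hκ hκ1 hfin
  obtain ⟨μ, hμprob, hμmap⟩ := exists_measure_map_restrict_eq ν h0 π hπprob hcons hdom hsupp
  set W : ℕ → Set Phase := fun k => window (Metric.ball (0 : Pos) k) with hWdef
  have hWm : ∀ k, MeasurableSet (W k) := fun k =>
    HardSphere.measurableSet_window Metric.isOpen_ball.measurableSet
  have hrm : ∀ k, Measurable (PointConfig.restrict (W k) : PointConfig Phase → PointConfig Phase) :=
    fun k => PointConfig.measurable_restrict (hWm k)
  have hH := HardSphere.measurableSet_hardCoreSet σ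
  -- `μ` is carried by hard-core configurations
  have hμHC : ∀ᵐ c ∂μ, IsHardCore σ c := by
    have hsub : {c : PointConfig Phase | ¬IsHardCore σ c} ⊆
        ⋃ k : ℕ, PointConfig.restrict (W k) ⁻¹' (hardCoreSet σ)ᶜ := by
      intro c hc
      simp only [mem_setOf_eq, IsHardCore, not_forall, not_le, exists_prop] at hc
      obtain ⟨x, hx, y, hy, hxy, hd⟩ := hc
      obtain ⟨k, hk⟩ := exists_nat_gt (max ‖x.1‖ ‖y.1‖)
      refine mem_iUnion.2 ⟨k, fun h => ?_⟩
      have hx' : x ∈ PointConfig.restrict (W k) c :=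
        ⟨hx, by rw [hWdef, HardSphere.mem_window, mem_ball_zero_iff]; exact lt_of_le_of_lt (le_max_left _ _) hk⟩
      have hy' : y ∈ PointConfig.restrict (W k) c :=
        ⟨hy, by rw [hWdef, HardSphere.mem_window, mem_ball_zero_iff]; exact lt_of_le_of_lt (le_max_right _ _) hk⟩
      exact absurd (h x hx' y hy' hxy) (not_le.2 hd)
    rw [ae_iff]
    refine measure_mono_null hsub ((measure_iUnion_null_iff).2 fun k => ?_)
    rw [← Measure.map_apply (hrm k) hH.compl, hμmap k]
    have h := hHC k
    rw [ae_iff] at h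
    exact h
  -- the DLR equations
  refine ⟨μ, hμprob, fun Λ hΛ hbdd A hA => ?_⟩
  obtain ⟨R, hR⟩ := hbdd.subset_ball (0 : Pos)
  have hνΛ : ν (window Λ) ≠ ∞ := ne_top_of_le_ne_top (hfin R) (measure_mono (window_mono hR))
  have hfmeas : Measurable fun η : PointConfig Phase => hsLocalSpec σ ν Λ η :=
    measurable_hsLocalSpec ν σ hΛ
  -- the mixed measure `A ↦ ∫ γ_Λ(A | η) dμ`
  set μγ : Measure (PointConfig Phase) := μ.bind fun η => hsLocalSpec σ ν Λ η with hμγ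
  have hμγ_apply : ∀ {B : Set (PointConfig Phase)}, MeasurableSet B →
      μγ B = ∫⁻ η, hsLocalSpec σ ν Λ η B ∂μ := fun hB => Measure.bind_apply hB hfmeas.aemeasurable
  haveI : IsFiniteMeasure μγ := by
    refine ⟨?_⟩
    rw [hμγ_apply MeasurableSet.univ]
    calc ∫⁻ η, hsLocalSpec σ ν Λ η univ ∂μ ≤ ∫⁻ _, 1 ∂μ :=
          lintegral_mono fun η => hsLocalSpec_apply_univ_le_one σ ν Λ η
      _ = 1 := by rw [lintegral_one, measure_univ]
      _ < ∞ := ENNReal.one_lt_top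
  have hext : μγ = μ := by
    refine ext_of_localEvents (fun j A' hA' => ?_) ?_
    · -- a local event over `B(0,j)`: enlarge the window to contain the `σ`-neighbourhood of `Λ`
      set J : ℕ := max j ⌈R + σ⌉₊ with hJ
      have hjJ : (j : ℝ) ≤ J := Nat.cast_le.2 (le_max_left _ _)
      have hRJ : R + σ ≤ J := (Nat.le_ceil _).trans (Nat.cast_le.2 (le_max_right _ _))
      have hΛσ : ∀ q ∈ Λ, ∀ p : Pos, dist p q < σ → p ∈ Metric.ball (0 : Pos) J := by
        intro q hq p hpq
        have hqR : ‖q‖ < R := by have := hR hq; rwa [mem_ball_zero_iff] at this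
        rw [mem_ball_zero_iff]
        calc ‖p‖ = dist p 0 := (dist_zero_right _).symm
          _ ≤ dist p q + dist q 0 := dist_triangle _ _ _
          _ < σ + R := by rw [dist_zero_right]; exact add_lt_add hpq hqR
          _ ≤ J := by linarith
      have hA''m : MeasurableSet (PointConfig.restrict (W j) ⁻¹' A' : Set (PointConfig Phase)) :=
        hA'.preimage (hrm j)
      have hAeq : PointConfig.restrict (W j) ⁻¹' A' =
          PointConfig.restrict (W J) ⁻¹' (PointConfig.restrict (W j) ⁻¹' A') :=
        preimage_restrict_eq_preimage_restrict_of_le hjJ A'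
      have hBm : MeasurableSet (PointConfig.restrict (W J) ⁻¹'
          (PointConfig.restrict (W j) ⁻¹' A') : Set (PointConfig Phase)) := hA''m.preimage (hrm J)
      change μγ (PointConfig.restrict (W j) ⁻¹' A') = μ (PointConfig.restrict (W j) ⁻¹' A')
      rw [hAeq, hμγ_apply hBm]
      calc ∫⁻ η, hsLocalSpec σ ν Λ η (PointConfig.restrict (W J) ⁻¹'
            (PointConfig.restrict (W j) ⁻¹' A')) ∂μ
          = ∫⁻ η, hsLocalSpec σ ν Λ (PointConfig.restrict (W J) η)
              (PointConfig.restrict (W J) ⁻¹' (PointConfig.restrict (W j) ⁻¹' A')) ∂μ := by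
            refine lintegral_congr_ae (hμHC.mono fun η hη => ?_)
            exact (hsLocalSpec_restrict_boundary_apply ν hΛ hΛσ hη hA''m).symm
        _ = ∫⁻ ω, hsLocalSpec σ ν Λ ω (PointConfig.restrict (W J) ⁻¹'
              (PointConfig.restrict (W j) ⁻¹' A')) ∂(μ.map (PointConfig.restrict (W J))) :=
            (lintegral_map (measurable_hsLocalSpec_apply ν σ hΛ hBm) (hrm J)).symm
        _ = π J (PointConfig.restrict (W j) ⁻¹' A') := by
            rw [hμmap J]; exact hDLR J Λ hΛ hΛσ _ hA''m
        _ = μ (PointConfig.restrict (W J) ⁻¹' (PointConfig.restrict (W j) ⁻¹' A')) := by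
            rw [← hμmap J, Measure.map_apply (hrm J) hA''m]
    · rw [hμγ_apply MeasurableSet.univ]
      have : ∀ᵐ η ∂μ, hsLocalSpec σ ν Λ η univ = 1 := hμHC.mono fun η hη => by
        haveI := isProbabilityMeasure_hsLocalSpec ν h0 hΛ hνΛ (hη.restrict (window Λ)ᶜ)
        exact measure_univ
      rw [lintegral_congr_ae this, lintegral_one]
  have h : μγ A = μ A := by rw [hext]
  rwa [hμγ_apply hA] at h

end Existence

end Literature.MathematicalPhysics.KineticTheory

end
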